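import Literature.MathematicalPhysics.QuantumFieldTheory.Balaban1983to89.B6BlockHolderCalculus
import Literature.MathematicalPhysics.QuantumFieldTheory.Balaban1983to89.B6BlockDecayGradFactorsV1

/-!
# `Balaban1983to89.B6BlockHolderLipschitzV1` — T. Bałaban, *Propagators and renormalization transformations for lattice gauge theories. II*,
# Commun. Math. Phys. **96** (1984) 223–250 [Balaban1984PropagatorsII], Proposition 2.5 p. 246 / [4] Prop. 1.2 (1.111) p. 35: HÖLDER-IN-THE-OUTPUT
# BLOCK BOUNDS FROM ONE MORE DERIVATIVE — on the fine torus of the model, block bounds of all the fine differences `∇_μ∘f` of an operator `f`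
# give the pair (Hölder) bounds of `f` for output pairs at unit distance `≤ 1`, by telescoping along lattice paths; instance: `∇_λ∂H′_j` of (2.129)
# from the THIRD derivatives of `H′_j` — file H2 of the (1.111) members of the two-level decay programme

statement-level skeleton of published theorems with citation tags; proofs where landed; nothing here is a claim about the Yang–Mills mass gap

PDF held: `paper:balaban1984-cmp96-propagators-rt-ii` (journal page = PDF page + 222), p. 246 [PDF 24]; `paper:balaban1984-cmp95-propagators-rt-i` ([4],
journal page = PDF page + 16), p. 35 [PDF 19].  PRINT.  [B6] p. 246 (verbatim, text layer): *"… derivatives of H_j up to third order, and their local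
Hölder norms as in (2.67), are uniformly bounded and have a uniform exponential decay with a decay rate depending on d only. All the above
considerations imply the following Proposition 2.5. The operator G_□ defined by (2.90) … satisfies all the inequalities (1.110)–(1.114) of the
Proposition 1.2 with a positive constant δ₂ instead of δ₀."*  [4] (1.109) p. 35: `‖∇A‖_α = max_{μ,ν} sup_{|x−x′| ≤ 1} |x − x′|^{−α}|(∂_μA_ν)(x) − (∂_μA_ν)(x′)|`.

CITATION HEADER (lean-in-tree rule) — WHAT IS REPRODUCED.  Phase-2 file of the `lit-balaban` typed skeleton (HOME `run/shared/lean/pub/lit-balaban/`),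
seat **p38 gen 21** (B6 fold owner r03, referee ref-4), FILE H2 of the (1.111) members of seat p22's Prop. 2.5 two-level decay programme (file H1
`…B6BlockHolderCalculus`: the pair-difference calculus); SKELETON rows **B6.Prop2.5** / **B6.Txt@246** (cells only; decls of record untouched).
THE MECHANISM (statements and proofs OURS): a kernel whose NEXT fine derivative is bounded is Lipschitz in the output variable at the unit scale,
and a Lipschitz quotient dominates every `α`-Hölder quotient at distance `≤ 1`.  §1 lattice paths on the torus `T^{(j)}` of `Setup` (`ℓ^∞` distance
`LatticeFieldCalculus.supDist`): for a pseudo-distance `S` on the sites, **`pseudoDist_le_path`** — if every unit step `c → c + e_μ` from a site `c`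
with `|x − c|_∞ ≤ |x − x′|_∞` costs `S(c, c + e_μ) ≤ B`, then `S(x, x′) ≤ d·|x − x′|_∞·B` (coordinate-by-coordinate staircase, each leg a straight
run of `cdist(x′_μ − x_μ) ≤ |x − x′|_∞` steps inside the ball; `leg_le`, `supDist_update_le`); §2 **`holderBound_of_blockBound_D`**: for
`f : ℓ²(κ) → ℓ²(fine bonds)` over `T^{(j)}` (positions `iterBlockOf j`), block bounds `(C, δ)` of ALL `D_μ∘f`, `D_μ = n(S_μ − I)` (p22's file 8,
written out), give at every output pair `b₁ = ⟨x, ν⟩`, `b₂ = ⟨x′, ν⟩` with `|x − x′|_∞ ≤ n = L^j` the pair bound `((d+1)·C·e^{δ}·|x − x′|_∞/n, δ)`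
anchored at `y(x)` (the path stays in the block of `x` or an adjacent one, `…BIJ85Ineq722Torus.supDist_blk_le_one`, which costs `e^{δ}`);
§3 THE INSTANCE `∇_λ∂H′_j` for `tsV1`: entries of `D_μD_λ∂H′_j` = `(c/n)·Re ∂_μ∂_λ∂_{μ₀}H′` (`dker_re_cons`, `DDgradHp_single_apply`; r03's
third-derivative kernels, `m = 3`, through p22's `abs_dker_re_le`), block bound `(|c|/n·A₃, κ)` (`blockBound_DDgradHp`) and
**`holderBound_DgradHp`**: the pair bound `((d+1)(|c|/n)A₃e^{κ}·|x − x′|_∞/n, κ)` of `D_λ∂H′_j` — the Hölder-in-the-output input for the first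
factors `∇∂H′_j` of `∇K₁`, `∇K₂*` in (2.129).  IMPORTS BY NAME (H1; p22's files 4, 8; r03; p09's torus geometry), restating nothing.  THEOREMS
ONLY; standard axioms.  HONEST SCOPE: (1) exponent-1 (Lipschitz) bounds; `|x − x′|^α`, `α < 1`, enters via H1's `self_le_rpow_of_le_one'` at the
assembly. (2) `∇` = forward difference with factor `η⁻¹ = L^j`; `c = L^j` only at the assembly. (3) constants ours.  NOT summit progress.
Unit `lit-balaban-p38` (gen 21), 2026-08-22.
-/

noncomputable section

open scoped InnerProductSpace BigOperators Matrix
open Finset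

namespace Literature.MathematicalPhysics.QuantumFieldTheory.Balaban1983to89.B6BlockHolderLipschitzV1

open LatticeFieldCalculus B5SectBStatements B5Eq117TorusCarriers B6SectAOperatorsV1 B6SectCOperators
  B6SectCTwoScaleV1 B6SectCTwoScaleV1Lattice B5Eq118OneStroke
open BalabanImbrieJaffe1984to88.BIJ85AxialPropagator411 (BondSpace)
open B4Sect5Torus (IsPseudoDist SumBound)
open B4TorusKernel (periodConst)
open B4TorusKernel.MultiPeriod (torusSupNorm torusSupNorm_nonneg)
open B3TorusRadialSums (cdist cdist_le_val cdist_neg cdist_le_supDist supDist_eq_sup_cdist supDist_comm supDist_eq_zero_iff eq_or_eq_neg_of_cdist_eq)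
open B5Prop11Plancherel (Tor fine)
open B5Action121 (sdiff_mulVec)
open B5Hk163Strip (kappaN kappaN_pos)
open B5Kernel166Decay (periodConst_pos)
open B6LowerBound2153Torus (rep)
open B6Hprime2132Holder (MGHD)
open B6Hprime2132Torus (HpOp iterD dker iterD_succ)
open B6HprimeOpNormV1 (EK_shift iterD_re_eq_sum card_filter_eq_le_one)
open B6BlockDecayCalculus (blockBound_of_entry torusDist_isPseudoDist)
open B6BlockDecayHprimeCovV1 (supDist_cast_eq_torusSupNorm gradHp_single_apply abs_dker_re_le MGHD_nonneg)
open B6BlockDecayGradFactorsV1 (Dop_comp_apply DgradHp_single_apply)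
open BalabanImbrieJaffe1984to88.BIJ85Ineq722Torus (supDist_blk_le_one)

/-! ## §1  Lattice paths on the torus `T^{(j)}`: a pseudo-distance is bounded by the number of unit steps times the step cost -/

section Path

variable {P : Params} {j : ℕ}

/-- coordinatewise criterion for `|x − w|_∞ ≤ D`. [cite: Balaban1982Higgs1, (1.3) p.604 (torus distance; ours)] -/
theorem supDist_le_of_cdist_le (x w : Site P j) {D : ℕ} (h : ∀ ν, cdist (x ν - w ν) ≤ D) : supDist x w ≤ D := by
  rw [supDist_eq_sup_cdist]
  exact Finset.sup_le fun ν _ => h ν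

/-- the circular size of the residue of `s ∈ ℕ` is at most `s`. [cite: Balaban1982Higgs1, (1.3) p.604 (torus distance; ours)] -/
theorem cdist_natCast_le {N : ℕ} [NeZero N] (s : ℕ) : cdist ((s : ZMod N)) ≤ s :=
  (cdist_le_val _).trans (by rw [ZMod.val_natCast]; exact Nat.mod_le s N)

/-- one more step of a straight run: `p + (s+1)e_μ = (p + se_μ) + e_μ`. [cite: Balaban1984PropagatorsI, (1.7) p.18 (straight contours; ours)] -/
theorem update_add_succ (p : Site P j) (μ : Fin P.d) (s : ℕ) :
    Function.update p μ (p μ + ((s + 1 : ℕ) : ZMod (P.sitesPerDir j))) =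
      Site.shift (Function.update p μ (p μ + (s : ZMod (P.sitesPerDir j)))) μ := by
  simp only [Site.shift, Function.update_idem, Function.update_self]
  congr 1
  push_cast
  ring

/-- **one leg**: if each of the `t` unit steps of the straight run `p, p + e_μ, …, p + te_μ` costs at most `B`, the run costs at most `t·B`.
[cite: Balaban1984PropagatorsI, (1.7) p.18 (straight contours; telescoping ours)] -/
theorem leg_le {S : Site P j → Site P j → ℝ} (hS : IsPseudoDist S) (p : Site P j) (μ : Fin P.d) {B : ℝ} :
    ∀ t : ℕ, (∀ s : ℕ, s < t → S (Function.update p μ (p μ + (s : ZMod (P.sitesPerDir j))))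
        (Site.shift (Function.update p μ (p μ + (s : ZMod (P.sitesPerDir j)))) μ) ≤ B) →
      S p (Function.update p μ (p μ + (t : ZMod (P.sitesPerDir j)))) ≤ t * B
  | 0, _ => by
      rw [Nat.cast_zero, add_zero, Function.update_eq_self, hS.zero, Nat.cast_zero, zero_mul]
  | t + 1, h => by
      have ih := leg_le hS p μ t (fun s hs => h s (Nat.lt_succ_of_lt hs))
      calc S p (Function.update p μ (p μ + ((t + 1 : ℕ) : ZMod (P.sitesPerDir j))))
          ≤ S p (Function.update p μ (p μ + (t : ZMod (P.sitesPerDir j)))) +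
              S (Function.update p μ (p μ + (t : ZMod (P.sitesPerDir j))))
                (Function.update p μ (p μ + ((t + 1 : ℕ) : ZMod (P.sitesPerDir j)))) := hS.triangle _ _ _
        _ ≤ t * B + B := add_le_add ih (by rw [update_add_succ]; exact h t (Nat.lt_succ_self t))
        _ = ((t + 1 : ℕ) : ℝ) * B := by push_cast; ring

/-- a site that agrees with `x` or `x′` off the coordinate `μ` and is within `|x − x′|_∞` of `x` in the coordinate `μ` lies in the ball
`|x − ·|_∞ ≤ |x − x′|_∞`. [cite: Balaban1982Higgs1, (1.3) p.604 (torus distance; ours)] -/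
theorem supDist_update_le (x x' p : Site P j) (μ : Fin P.d) (hp : ∀ ν, ν ≠ μ → p ν = x ν ∨ p ν = x' ν)
    (hμ : cdist (x μ - p μ) ≤ supDist x x') : supDist x p ≤ supDist x x' := by
  refine supDist_le_of_cdist_le x p fun ν => ?_
  by_cases hν : ν = μ
  · subst hν; exact hμ
  · rcases hp ν hν with h | h
    · rw [h, sub_self]
      exact (cdist_le_val _).trans (by rw [ZMod.val_zero]; exact Nat.zero_le _)
    · rw [h]; exact cdist_le_supDist x x' ν

/-- **THE PATH LEMMA**: let `S` be a pseudo-distance on the sites of `T^{(j)}`; if every unit step `c → c + e_μ` from a site `c` with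
`|x − c|_∞ ≤ |x − x′|_∞` costs `S(c, c + e_μ) ≤ B` (`B ≥ 0`), then `S(x, x′) ≤ d·|x − x′|_∞·B` — along the staircase changing the coordinates one
at a time, each leg a straight run of `cdist(x′_μ − x_μ) ≤ |x − x′|_∞` steps (forward, or backward read from its far end) inside the ball.
[cite: Balaban1984PropagatorsI, (1.7) p.18 (staircase contours Γ_{y,x}; the estimate ours)] -/
theorem pseudoDist_le_path {S : Site P j → Site P j → ℝ} (hS : IsPseudoDist S) (x x' : Site P j) {B : ℝ} (hB : 0 ≤ B)
    (hstep : ∀ (c : Site P j) (μ : Fin P.d), supDist x c ≤ supDist x x' → S c (c.shift μ) ≤ B) :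
    S x x' ≤ (P.d : ℝ) * (supDist x x' : ℝ) * B := by
  set D : ℕ := supDist x x' with hD
  -- the corners of the staircase: `z i` has the coordinates `< i` of `x′` and the others of `x`
  set z : ℕ → Site P j := fun i ν => if (ν : ℕ) < i then x' ν else x ν with hz
  have hz0 : z 0 = x := funext fun ν => by simp [hz]
  have hzd : z P.d = x' := funext fun ν => by simp [hz, ν.isLt]
  have hzi : ∀ (i : Fin P.d), z i i = x i := fun i => by simp [hz]
  have hzs : ∀ (i : Fin P.d), z (i + 1) = Function.update (z i) i (x' i) := by
    intro i
    funext ν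
    by_cases hν : ν = i
    · subst hν
      rw [Function.update_self]
      simp [hz]
    · rw [Function.update_of_ne hν]
      have hne : (ν : ℕ) ≠ i := fun h => hν (Fin.ext h)
      simp only [hz]
      by_cases h1 : (ν : ℕ) < i
      · rw [if_pos h1, if_pos (by omega)]
      · rw [if_neg h1, if_neg (by omega)]
  have hzoff : ∀ (i : Fin P.d) (ν : Fin P.d), z i ν = x ν ∨ z i ν = x' ν := fun i ν => by
    simp only [hz]; split_ifs
    · exact Or.inr rfl
    · exact Or.inl rfl
  -- each leg costs at most `D·B`
  have hleg : ∀ i : Fin P.d, S (z i) (z (i + 1)) ≤ D * B := by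
    intro i
    obtain ⟨t, ht_def⟩ : ∃ t : ℕ, cdist (x' i - x i) = t := ⟨_, rfl⟩
    have ht : t ≤ D := by rw [← ht_def, hD, supDist_comm]; exact cdist_le_supDist x' x i
    have hDB : (t : ℝ) * B ≤ D * B := mul_le_mul_of_nonneg_right (by exact_mod_cast ht) hB
    rcases eq_or_eq_neg_of_cdist_eq (x' i - x i) t ht_def with h | h
    · -- forward run from `z i`
      have hx' : x' i = z i i + (t : ZMod (P.sitesPerDir j)) := by rw [hzi, ← h]; ring
      rw [hzs i, hx']
      refine (leg_le hS (z i) i _ fun s hs => hstep _ _ ?_).trans hDB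
      refine supDist_update_le x x' _ i (fun ν hν => ?_) ?_
      · rw [Function.update_of_ne hν]; exact hzoff i ν
      · rw [Function.update_self, hzi, sub_add_cancel_left, cdist_neg]
        exact (cdist_natCast_le s).trans (hs.le.trans ht)
    · -- backward run: the forward run from `z (i+1)` back to `z i`
      have hx : x i = x' i + (t : ZMod (P.sitesPerDir j)) := by
        have e : x i = x' i - (x' i - x i) := by ring
        rw [e, h]; ring
      have hzi' : z (i + 1) i = x' i := by rw [hzs i, Function.update_self]
      have hback : z i = Function.update (z (i + 1)) i (z (i + 1) i + (t : ZMod (P.sitesPerDir j))) := by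
        rw [hzi', ← hx, hzs i, Function.update_idem, ← hzi i, Function.update_eq_self]
      rw [hS.symm, hback]
      refine (leg_le hS (z (i + 1)) i _ fun s hs => hstep _ _ ?_).trans hDB
      refine supDist_update_le x x' _ i (fun ν hν => ?_) ?_
      · rw [Function.update_of_ne hν, hzs i, Function.update_of_ne hν]; exact hzoff i ν
      · rw [Function.update_self, hzi', hx]
        have e : x' i + (t : ZMod (P.sitesPerDir j)) - (x' i + (s : ZMod (P.sitesPerDir j))) =
            ((t - s : ℕ) : ZMod (P.sitesPerDir j)) := by
          rw [Nat.cast_sub hs.le]; ring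
        rw [e]
        exact (cdist_natCast_le _).trans ((Nat.sub_le _ _).trans ht)
  -- telescoping over the legs
  have htel : ∀ n : ℕ, n ≤ P.d → S (z 0) (z n) ≤ n * (D * B) := by
    intro n
    induction n with
    | zero => intro _; rw [hS.zero, Nat.cast_zero, zero_mul]
    | succ n ih =>
        intro hn
        have h1 := ih (Nat.le_of_succ_le hn)
        have h2 := hleg ⟨n, hn⟩
        calc S (z 0) (z (n + 1)) ≤ S (z 0) (z n) + S (z n) (z (n + 1)) := hS.triangle _ _ _
          _ ≤ n * (D * B) + D * B := add_le_add h1 h2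
          _ = ((n + 1 : ℕ) : ℝ) * (D * B) := by push_cast; ring
  have h := htel P.d le_rfl
  rw [hz0, hzd] at h
  calc S x x' ≤ (P.d : ℝ) * (D * B) := h
    _ = _ := by rw [hD]; ring

end Path

/-! ## §2  Block bounds of all `D_μ∘f` ⇒ pair bounds of `f` at fine pairs at unit distance `≤ 1` -/

section Lipschitz

variable {d L m K : ℕ} {hd : 1 ≤ d + 1} {hL : Odd L ∧ 1 < L} {j : ℕ} {κ : Type} [Fintype κ] [DecidableEq κ]

/-- **LIPSCHITZ IN THE OUTPUT FROM THE DIFFERENCES**: let `f : ℓ²(κ) → ℓ²(fine bonds)` be an operator over the unit lattice `T^{(j)}` whose fine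
differences `D_μ∘f = n(S_μ − I)∘f` ALL have the block bound `(C, δ)` (`C, δ ≥ 0`). Then for fine bonds `b₁ = ⟨x, ν⟩`, `b₂ = ⟨x′, ν⟩` (same
direction) with `|x − x′|_∞ ≤ n = L^j` and every unit site `y`:
`Σ_{k : pκ k = y}|f(e_k)_{b₁} − f(e_k)_{b₂}| ≤ (d+1)·C·e^{δ}·(|x − x′|_∞/n)·e^{−δ|y(x) − y|_T}` — the pair (Hölder-in-the-output, exponent 1) bound
of H1 anchored at `y(x)`.  Each unit step costs `n⁻¹` times the block bound of `D_μ∘f` at a site in the block of `x` or an adjacent one.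
[cite: Balaban1984PropagatorsII, Prop. 2.5 p.246 («derivatives … uniformly bounded» ⇒ Hölder; mechanism ours); Balaban1984PropagatorsI, (1.109) p.35] -/
theorem holderBound_of_blockBound_D (hj : j ≤ (⟨d + 1, L, m, K, hd, hL⟩ : Params).m + (⟨d + 1, L, m, K, hd, hL⟩ : Params).K)
    (f : EuclideanSpace ℝ κ →ₗ[ℝ] BondSpace (⟨d + 1, L, m, K, hd, hL⟩ : Params)) (pκ : κ → Site (⟨d + 1, L, m, K, hd, hL⟩ : Params) j)
    {C δ : ℝ} (hC : 0 ≤ C) (hδ : 0 ≤ δ)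
    (hD : ∀ (μ : Fin (d + 1)) (b₀ : PBond (⟨d + 1, L, m, K, hd, hL⟩ : Params) 0) (y : Site (⟨d + 1, L, m, K, hd, hL⟩ : Params) j),
      ∑ k ∈ univ.filter (fun k => pκ k = y),
        |(((((L : ℝ) ^ j) • (onE (LinearMap.funLeft ℝ ℝ (fun b : PBond (⟨d + 1, L, m, K, hd, hL⟩ : Params) 0 =>
            (⟨b.src.shift μ, b.dir⟩ : PBond (⟨d + 1, L, m, K, hd, hL⟩ : Params) 0))) - LinearMap.id) :
          BondSpace (⟨d + 1, L, m, K, hd, hL⟩ : Params) →ₗ[ℝ] BondSpace (⟨d + 1, L, m, K, hd, hL⟩ : Params))) ∘ₗ f) (EuclideanSpace.single k (1 : ℝ)) b₀| ≤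
        C * Real.exp (-(δ * torusSupNorm (Mk (⟨d + 1, L, m, K, hd, hL⟩ : Params) j)
          (rep (Mk (⟨d + 1, L, m, K, hd, hL⟩ : Params) j) (iterBlockOf j b₀.src) - rep (Mk (⟨d + 1, L, m, K, hd, hL⟩ : Params) j) y))))
    (b₁ b₂ : PBond (⟨d + 1, L, m, K, hd, hL⟩ : Params) 0) (hdir : b₁.dir = b₂.dir) (hle : supDist b₁.src b₂.src ≤ L ^ j)
    (y : Site (⟨d + 1, L, m, K, hd, hL⟩ : Params) j) :
    ∑ k ∈ univ.filter (fun k => pκ k = y), |f (EuclideanSpace.single k (1 : ℝ)) b₁ - f (EuclideanSpace.single k (1 : ℝ)) b₂| ≤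
      ((d + 1 : ℕ) : ℝ) * C * Real.exp δ * ((supDist b₁.src b₂.src : ℝ) / (L : ℝ) ^ j) *
        Real.exp (-(δ * torusSupNorm (Mk (⟨d + 1, L, m, K, hd, hL⟩ : Params) j)
          (rep (Mk (⟨d + 1, L, m, K, hd, hL⟩ : Params) j) (iterBlockOf j b₁.src) - rep (Mk (⟨d + 1, L, m, K, hd, hL⟩ : Params) j) y))) := by
  have hL0 : 0 < L := by have := hL.2; omega
  have hn : (0 : ℝ) < (L : ℝ) ^ j := by positivity
  have hρ := torusDist_isPseudoDist (Mk (⟨d + 1, L, m, K, hd, hL⟩ : Params) j)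
  -- the pseudo-distance `S(c, c′) = Σ_{k∈y}|f(e_k)_{⟨c,ν⟩} − f(e_k)_{⟨c′,ν⟩}|` on the fine sites
  set S : Site (⟨d + 1, L, m, K, hd, hL⟩ : Params) 0 → Site (⟨d + 1, L, m, K, hd, hL⟩ : Params) 0 → ℝ := fun c c' =>
    ∑ k ∈ univ.filter (fun k => pκ k = y), |f (EuclideanSpace.single k (1 : ℝ)) ⟨c, b₁.dir⟩ - f (EuclideanSpace.single k (1 : ℝ)) ⟨c', b₁.dir⟩|
    with hSdef
  have hS : IsPseudoDist S :=
    { symm := fun c c' => Finset.sum_congr rfl fun k _ => abs_sub_comm _ _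
      zero := fun c => Finset.sum_eq_zero fun k _ => by rw [sub_self, abs_zero]
      triangle := fun c c' c'' => by
        simp only [hSdef]
        rw [← Finset.sum_add_distrib]
        exact Finset.sum_le_sum fun k _ => abs_sub_le _ _ _ }
  set E : ℝ := Real.exp (-(δ * torusSupNorm (Mk (⟨d + 1, L, m, K, hd, hL⟩ : Params) j)
    (rep (Mk (⟨d + 1, L, m, K, hd, hL⟩ : Params) j) (iterBlockOf j b₁.src) - rep (Mk (⟨d + 1, L, m, K, hd, hL⟩ : Params) j) y))) with hE
  set B : ℝ := C / (L : ℝ) ^ j * Real.exp δ * E with hB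
  have hB0 : 0 ≤ B := by positivity
  -- the cost of one unit step from a site of the ball
  have hstep : ∀ (c : Site (⟨d + 1, L, m, K, hd, hL⟩ : Params) 0) (μ : Fin (d + 1)), supDist b₁.src c ≤ supDist b₁.src b₂.src →
      S c (c.shift μ) ≤ B := by
    intro c μ hc
    -- `S(c, c + e_μ) = n⁻¹ Σ_{k∈y} |(D_μ f)(e_k)_{⟨c,ν⟩}|`
    have e1 : S c (c.shift μ) = ((L : ℝ) ^ j)⁻¹ * ∑ k ∈ univ.filter (fun k => pκ k = y),
        |(((((L : ℝ) ^ j) • (onE (LinearMap.funLeft ℝ ℝ (fun b : PBond (⟨d + 1, L, m, K, hd, hL⟩ : Params) 0 =>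
            (⟨b.src.shift μ, b.dir⟩ : PBond (⟨d + 1, L, m, K, hd, hL⟩ : Params) 0))) - LinearMap.id) :
          BondSpace (⟨d + 1, L, m, K, hd, hL⟩ : Params) →ₗ[ℝ] BondSpace (⟨d + 1, L, m, K, hd, hL⟩ : Params))) ∘ₗ f)
          (EuclideanSpace.single k (1 : ℝ)) ⟨c, b₁.dir⟩| := by
      simp only [hSdef]
      rw [Finset.mul_sum]
      refine Finset.sum_congr rfl fun k _ => ?_
      rw [Dop_comp_apply, abs_mul, abs_of_pos hn, ← mul_assoc, inv_mul_cancel₀ hn.ne', one_mul, abs_sub_comm]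
    -- the block of `c` is within `1` of the block of `x`
    have hcx : supDist b₁.src c ≤ L ^ j := hc.trans hle
    have hblk : torusSupNorm (Mk (⟨d + 1, L, m, K, hd, hL⟩ : Params) j)
        (rep (Mk (⟨d + 1, L, m, K, hd, hL⟩ : Params) j) (iterBlockOf j b₁.src) - rep (Mk (⟨d + 1, L, m, K, hd, hL⟩ : Params) j) (iterBlockOf j c)) ≤ 1 := by
      rw [← supDist_cast_eq_torusSupNorm]
      exact_mod_cast supDist_blk_le_one hj b₁.src c hcx
    have hexp : Real.exp (-(δ * torusSupNorm (Mk (⟨d + 1, L, m, K, hd, hL⟩ : Params) j)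
        (rep (Mk (⟨d + 1, L, m, K, hd, hL⟩ : Params) j) (iterBlockOf j c) - rep (Mk (⟨d + 1, L, m, K, hd, hL⟩ : Params) j) y))) ≤ Real.exp δ * E := by
      rw [hE, ← Real.exp_add]
      apply Real.exp_le_exp.2
      have t := hρ.triangle (iterBlockOf j b₁.src) (iterBlockOf j c) y
      nlinarith [mul_le_mul_of_nonneg_left t hδ, mul_le_mul_of_nonneg_left hblk hδ]
    rw [e1, hB]
    calc ((L : ℝ) ^ j)⁻¹ * _ ≤ ((L : ℝ) ^ j)⁻¹ * (C * Real.exp (-(δ * torusSupNorm (Mk (⟨d + 1, L, m, K, hd, hL⟩ : Params) j)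
          (rep (Mk (⟨d + 1, L, m, K, hd, hL⟩ : Params) j) (iterBlockOf j c) - rep (Mk (⟨d + 1, L, m, K, hd, hL⟩ : Params) j) y)))) :=
          mul_le_mul_of_nonneg_left (hD μ ⟨c, b₁.dir⟩ y) (inv_nonneg.2 hn.le)
      _ ≤ ((L : ℝ) ^ j)⁻¹ * (C * (Real.exp δ * E)) := mul_le_mul_of_nonneg_left (mul_le_mul_of_nonneg_left hexp hC) (inv_nonneg.2 hn.le)
      _ = C / (L : ℝ) ^ j * Real.exp δ * E := by rw [div_eq_mul_inv]; ring
  have h := pseudoDist_le_path hS b₁.src b₂.src hB0 hstep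
  have hb₂ : b₂ = ⟨b₂.src, b₁.dir⟩ := by rw [hdir]
  have hSx : S b₁.src b₂.src = ∑ k ∈ univ.filter (fun k => pκ k = y),
      |f (EuclideanSpace.single k (1 : ℝ)) b₁ - f (EuclideanSpace.single k (1 : ℝ)) b₂| := by
    simp only [hSdef]
    conv_rhs => rw [hb₂]
  rw [← hSx]
  refine h.trans (le_of_eq ?_)
  rw [hB, show ((⟨d + 1, L, m, K, hd, hL⟩ : Params).d : ℝ) = ((d + 1 : ℕ) : ℝ) from rfl]
  rw [div_eq_mul_inv, div_eq_mul_inv]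
  ring

end Lipschitz

/-! ## §3  The instance `∇_λ∂H′_j` of (2.129) for `tsV1`: third derivatives of `H′_j` -/

section DDgradHp

variable {P : Params} {c : ℝ} (hc : c ≠ 0) {j : ℕ} (hj : j ≤ P.m + P.K) (Λ' : Finset (Site P (j + 1))) (w : CIdx j Λ' → ℝ)

include hj in
/-- **`Re ∂_λ∂^{m}_{νs}H′ = n·(Re ∂^{m}_{νs}H′(· + e_λ) − Re ∂^{m}_{νs}H′)`** at fine points `EK x`, for every multi-direction `νs` (r03's `iterD_succ` on the
column `H′e_y`; p22's `dker_re_two` is the case `m = 1`). [cite: Balaban1984PropagatorsI, (1.4) p.18; Balaban1984PropagatorsII, p.246 («derivatives of H′_j up to third order»)] -/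
theorem dker_re_cons {mo : ℕ} (lam : Fin P.d) (νs : Fin mo → Fin P.d) (x : Site P 0) (y : Site P j) :
    (dker (P.L ^ j) (Mk P j) (Fin.cons lam νs : Fin (mo + 1) → Fin P.d) (EK hj x) y).re =
      ((P.L : ℝ) ^ j) * ((dker (P.L ^ j) (Mk P j) νs (EK hj (x.shift lam)) y).re - (dker (P.L ^ j) (Mk P j) νs (EK hj x) y).re) := by
  classical
  have e : ∀ {mo' : ℕ} (νs' : Fin mo' → Fin P.d) (z : Tor (fine (P.L ^ j) (Mk P j))),
      (dker (P.L ^ j) (Mk P j) νs' z y).re =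
        (iterD (P.L ^ j) (Mk P j) mo' νs' (HpOp (P.L ^ j) (Mk P j) *ᵥ cplxS (tSc (WithLp.ofLp (EuclideanSpace.single y (1 : ℝ))))) z).re := by
    intro mo' νs' z
    rw [iterD_re_eq_sum]
    simp only [PiLp.single_apply, mul_ite, mul_one, mul_zero, Finset.sum_ite_eq', Finset.mem_univ, if_true]
  rw [e, e, e, iterD_succ, sdiff_mulVec, show Fin.tail (Fin.cons lam νs : Fin (mo + 1) → Fin P.d) = νs from Fin.tail_cons _ _,
    show (Fin.cons lam νs : Fin (mo + 1) → Fin P.d) 0 = lam from rfl, ← EK_shift hj]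
  simp only [Complex.mul_re, Complex.sub_re, Complex.natCast_re, Complex.natCast_im, zero_mul, sub_zero]
  push_cast
  ring

include hj in
/-- **THE ENTRIES OF `D_μD_λ∂H′_j`**: `(D_μD_λ∂H′_j)(e_y)_{b₀} = (c/n)·Re ∂_μ∂_λ∂_{μ₀}H′(EK b₀₋, y)` (p22's `DgradHp_single_apply` at `b₀` and `b₀ + e_μ`).
[cite: Balaban1984PropagatorsII, p.246 («derivatives of H′_j up to third order»)] -/
theorem DDgradHp_single_apply (μ lam : Fin P.d) (y : Site P j) (b₀ : PBond P 0) :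
    (((((P.L : ℝ) ^ j) • (onE (LinearMap.funLeft ℝ ℝ (fun b : PBond P 0 =>
          (⟨b.src.shift μ, b.dir⟩ : PBond P 0))) - LinearMap.id) :
        BondSpace P →ₗ[ℝ] BondSpace P)) ∘ₗ
        ((((P.L : ℝ) ^ j) • (onE (LinearMap.funLeft ℝ ℝ (fun b : PBond P 0 =>
          (⟨b.src.shift lam, b.dir⟩ : PBond P 0))) - LinearMap.id) :
        BondSpace P →ₗ[ℝ] BondSpace P)) ∘ₗ
          ((tsV1 hc Λ' w).grad ∘ₗ (tsV1 hc Λ' w).hP)) (EuclideanSpace.single y (1 : ℝ)) b₀ =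
      c / (P.L : ℝ) ^ j * (dker (P.L ^ j) (Mk P j) ![μ, lam, b₀.dir] (EK hj b₀.src) y).re := by
  rw [Dop_comp_apply, DgradHp_single_apply hc hj Λ' w lam y ⟨b₀.src.shift μ, b₀.dir⟩, DgradHp_single_apply hc hj Λ' w lam y b₀,
    show (![μ, lam, b₀.dir] : Fin 3 → Fin P.d) = Fin.cons μ ![lam, b₀.dir] from rfl, dker_re_cons hj]
  ring

end DDgradHp

section DDgradHpBlock

variable {d L m K : ℕ} [NeZero L] {hd : 1 ≤ d + 1} {hL : Odd L ∧ 1 < L} {c : ℝ} (hc : c ≠ 0) {j : ℕ}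
  (hj : j ≤ (⟨d + 1, L, m, K, hd, hL⟩ : Params).m + (⟨d + 1, L, m, K, hd, hL⟩ : Params).K)
  (Λ' : Finset (Site (⟨d + 1, L, m, K, hd, hL⟩ : Params) (j + 1))) (w : CIdx j Λ' → ℝ)

include hj in
/-- **THE ENTRIES OF `D_μD_λ∂H′_j` DECAY**: `|(D_μD_λ∂H′_j)(e_y)_{b₀}| ≤ (|c|/n)·A₃·e^{−κ|y(b₀₋) − y|_T}`, `A₃ = MGHD(d+1,3)·periodConst(κ_N(d+1),d)` (p22's
`abs_dker_re_le`, `m = 3`: «derivatives of H′_j up to third order … uniformly bounded»). [cite: Balaban1984PropagatorsII, p.246 (text after (2.132))] -/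
theorem abs_DDgradHp_entry_le (μ lam : Fin (d + 1)) (y : Site (⟨d + 1, L, m, K, hd, hL⟩ : Params) j) (b₀ : PBond (⟨d + 1, L, m, K, hd, hL⟩ : Params) 0) :
    |(((((L : ℝ) ^ j) • (onE (LinearMap.funLeft ℝ ℝ (fun b : PBond (⟨d + 1, L, m, K, hd, hL⟩ : Params) 0 =>
            (⟨b.src.shift μ, b.dir⟩ : PBond (⟨d + 1, L, m, K, hd, hL⟩ : Params) 0))) - LinearMap.id) :
          BondSpace (⟨d + 1, L, m, K, hd, hL⟩ : Params) →ₗ[ℝ] BondSpace (⟨d + 1, L, m, K, hd, hL⟩ : Params))) ∘ₗ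
          ((((L : ℝ) ^ j) • (onE (LinearMap.funLeft ℝ ℝ (fun b : PBond (⟨d + 1, L, m, K, hd, hL⟩ : Params) 0 =>
            (⟨b.src.shift lam, b.dir⟩ : PBond (⟨d + 1, L, m, K, hd, hL⟩ : Params) 0))) - LinearMap.id) :
          BondSpace (⟨d + 1, L, m, K, hd, hL⟩ : Params) →ₗ[ℝ] BondSpace (⟨d + 1, L, m, K, hd, hL⟩ : Params))) ∘ₗ
            ((tsV1 hc Λ' w).grad ∘ₗ (tsV1 hc Λ' w).hP)) (EuclideanSpace.single y (1 : ℝ)) b₀| ≤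
      |c| / (L : ℝ) ^ j * (MGHD (d + 1) 3 * periodConst (kappaN (d + 1)) d) * Real.exp (-(kappaN (d + 1) / ((d : ℝ) + 1) *
        torusSupNorm (Mk (⟨d + 1, L, m, K, hd, hL⟩ : Params) j)
          (rep (Mk (⟨d + 1, L, m, K, hd, hL⟩ : Params) j) (iterBlockOf j b₀.src) - rep (Mk (⟨d + 1, L, m, K, hd, hL⟩ : Params) j) y))) := by
  have hLj : (0 : ℝ) < (L : ℝ) ^ j := pow_pos (Nat.cast_pos.2 (Nat.pos_of_ne_zero (NeZero.ne L))) _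
  have h := DDgradHp_single_apply (P := (⟨d + 1, L, m, K, hd, hL⟩ : Params)) hc hj Λ' w μ lam y b₀
  rw [show (((⟨d + 1, L, m, K, hd, hL⟩ : Params).L : ℝ) ^ j) = (L : ℝ) ^ j from rfl] at h
  rw [h, abs_mul, abs_div, abs_of_pos hLj, mul_assoc]
  exact mul_le_mul_of_nonneg_left (abs_dker_re_le hj (by norm_num) ![μ, lam, b₀.dir] b₀.src y) (by positivity)

include hj in
/-- **block bound for `D_μD_λ∂H′_j`** (unit sites → fine bonds): `(|c|/n·A₃, κ)`. [cite: Balaban1984PropagatorsII, p.246 (text after (2.132))] -/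
theorem blockBound_DDgradHp (μ lam : Fin (d + 1)) (b₀ : PBond (⟨d + 1, L, m, K, hd, hL⟩ : Params) 0) (y : Site (⟨d + 1, L, m, K, hd, hL⟩ : Params) j) :
    ∑ y' ∈ univ.filter (fun y' : Site (⟨d + 1, L, m, K, hd, hL⟩ : Params) j => y' = y),
        |(((((L : ℝ) ^ j) • (onE (LinearMap.funLeft ℝ ℝ (fun b : PBond (⟨d + 1, L, m, K, hd, hL⟩ : Params) 0 =>
              (⟨b.src.shift μ, b.dir⟩ : PBond (⟨d + 1, L, m, K, hd, hL⟩ : Params) 0))) - LinearMap.id) :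
            BondSpace (⟨d + 1, L, m, K, hd, hL⟩ : Params) →ₗ[ℝ] BondSpace (⟨d + 1, L, m, K, hd, hL⟩ : Params))) ∘ₗ
            ((((L : ℝ) ^ j) • (onE (LinearMap.funLeft ℝ ℝ (fun b : PBond (⟨d + 1, L, m, K, hd, hL⟩ : Params) 0 =>
              (⟨b.src.shift lam, b.dir⟩ : PBond (⟨d + 1, L, m, K, hd, hL⟩ : Params) 0))) - LinearMap.id) :
            BondSpace (⟨d + 1, L, m, K, hd, hL⟩ : Params) →ₗ[ℝ] BondSpace (⟨d + 1, L, m, K, hd, hL⟩ : Params))) ∘ₗ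
              ((tsV1 hc Λ' w).grad ∘ₗ (tsV1 hc Λ' w).hP)) (EuclideanSpace.single y' (1 : ℝ)) b₀| ≤
      |c| / (L : ℝ) ^ j * (MGHD (d + 1) 3 * periodConst (kappaN (d + 1)) d) * ((1 : ℕ) : ℝ) * Real.exp (-(kappaN (d + 1) / ((d : ℝ) + 1) *
        torusSupNorm (Mk (⟨d + 1, L, m, K, hd, hL⟩ : Params) j)
          (rep (Mk (⟨d + 1, L, m, K, hd, hL⟩ : Params) j) (iterBlockOf j b₀.src) - rep (Mk (⟨d + 1, L, m, K, hd, hL⟩ : Params) j) y))) := by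
  have hLj : (0 : ℝ) < (L : ℝ) ^ j := pow_pos (Nat.cast_pos.2 (Nat.pos_of_ne_zero (NeZero.ne L))) _
  exact blockBound_of_entry (ρ := (fun t t' : Site (⟨d + 1, L, m, K, hd, hL⟩ : Params) j => torusSupNorm (Mk (⟨d + 1, L, m, K, hd, hL⟩ : Params) j)
      (rep (Mk (⟨d + 1, L, m, K, hd, hL⟩ : Params) j) t - rep (Mk (⟨d + 1, L, m, K, hd, hL⟩ : Params) j) t')))
    _ (fun b₀ : PBond (⟨d + 1, L, m, K, hd, hL⟩ : Params) 0 => iterBlockOf j b₀.src)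
    (fun y : Site (⟨d + 1, L, m, K, hd, hL⟩ : Params) j => y)
    (mul_nonneg (div_nonneg (abs_nonneg c) hLj.le) (mul_nonneg (MGHD_nonneg _ _) (periodConst_pos (kappaN_pos _) _).le))
    (card_filter_eq_le_one (P := (⟨d + 1, L, m, K, hd, hL⟩ : Params)) (j := j)) (fun b₀ y => abs_DDgradHp_entry_le hc hj Λ' w μ lam y b₀) b₀ y

include hj in
/-- **THE PAIR (HÖLDER-IN-THE-OUTPUT) BOUND OF `D_λ∂H′_j`**: for fine bonds `b₁ = ⟨x, ν⟩`, `b₂ = ⟨x′, ν⟩` with `|x − x′|_∞ ≤ n` and every unit site `y`,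
`Σ_{y′ = y}|(D_λ∂H′_j)(e_{y′})_{b₁} − (D_λ∂H′_j)(e_{y′})_{b₂}| ≤ (d+1)(|c|/n)A₃e^{κ}·(|x − x′|_∞/n)·e^{−κ|y(x) − y|_T}`, `κ = κ_N(d+1)/(d+1)` — the first factors
`∇∂H′_j` of `∇K₁`, `∇K₂*` are Lipschitz, hence `α`-Hölder, in the output, uniformly (§2 with §3's block bounds of `D_μD_λ∂H′_j`).
[cite: Balaban1984PropagatorsII, Prop. 2.5 p.246 («their local Hölder norms … uniformly bounded»); Balaban1984PropagatorsI, (1.111) p.35] -/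
theorem holderBound_DgradHp (lam : Fin (d + 1)) (b₁ b₂ : PBond (⟨d + 1, L, m, K, hd, hL⟩ : Params) 0) (hdir : b₁.dir = b₂.dir)
    (hle : supDist b₁.src b₂.src ≤ L ^ j) (y : Site (⟨d + 1, L, m, K, hd, hL⟩ : Params) j) :
    ∑ y' ∈ univ.filter (fun y' : Site (⟨d + 1, L, m, K, hd, hL⟩ : Params) j => y' = y),
        |(((((L : ℝ) ^ j) • (onE (LinearMap.funLeft ℝ ℝ (fun b : PBond (⟨d + 1, L, m, K, hd, hL⟩ : Params) 0 =>
              (⟨b.src.shift lam, b.dir⟩ : PBond (⟨d + 1, L, m, K, hd, hL⟩ : Params) 0))) - LinearMap.id) :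
            BondSpace (⟨d + 1, L, m, K, hd, hL⟩ : Params) →ₗ[ℝ] BondSpace (⟨d + 1, L, m, K, hd, hL⟩ : Params))) ∘ₗ
              ((tsV1 hc Λ' w).grad ∘ₗ (tsV1 hc Λ' w).hP)) (EuclideanSpace.single y' (1 : ℝ)) b₁ -
         (((((L : ℝ) ^ j) • (onE (LinearMap.funLeft ℝ ℝ (fun b : PBond (⟨d + 1, L, m, K, hd, hL⟩ : Params) 0 =>
              (⟨b.src.shift lam, b.dir⟩ : PBond (⟨d + 1, L, m, K, hd, hL⟩ : Params) 0))) - LinearMap.id) :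
            BondSpace (⟨d + 1, L, m, K, hd, hL⟩ : Params) →ₗ[ℝ] BondSpace (⟨d + 1, L, m, K, hd, hL⟩ : Params))) ∘ₗ
              ((tsV1 hc Λ' w).grad ∘ₗ (tsV1 hc Λ' w).hP)) (EuclideanSpace.single y' (1 : ℝ)) b₂| ≤
      ((d + 1 : ℕ) : ℝ) * (|c| / (L : ℝ) ^ j * (MGHD (d + 1) 3 * periodConst (kappaN (d + 1)) d) * ((1 : ℕ) : ℝ)) *
        Real.exp (kappaN (d + 1) / ((d : ℝ) + 1)) * ((supDist b₁.src b₂.src : ℝ) / (L : ℝ) ^ j) *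
        Real.exp (-(kappaN (d + 1) / ((d : ℝ) + 1) * torusSupNorm (Mk (⟨d + 1, L, m, K, hd, hL⟩ : Params) j)
          (rep (Mk (⟨d + 1, L, m, K, hd, hL⟩ : Params) j) (iterBlockOf j b₁.src) - rep (Mk (⟨d + 1, L, m, K, hd, hL⟩ : Params) j) y))) := by
  exact holderBound_of_blockBound_D hj _ (fun y : Site (⟨d + 1, L, m, K, hd, hL⟩ : Params) j => y)
    (by have := MGHD_nonneg (d + 1) 3; have := periodConst_pos (kappaN_pos (d + 1)) d; positivity)
    (div_nonneg (kappaN_pos _).le (by positivity))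
    (fun μ b₀ y => by rw [← LinearMap.comp_assoc]; exact blockBound_DDgradHp hc hj Λ' w μ lam b₀ y) b₁ b₂ hdir hle y

end DDgradHpBlock

end Literature.MathematicalPhysics.QuantumFieldTheory.Balaban1983to89.B6BlockHolderLipschitzV1

end
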